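import Summits.RiemannHypothesis.RiemannHypothesis.Theorems.PfPersistenceF1PWOneFreq

/-!
# PF persistence, fake seat 1 — the round member's transient has a non-empty index set (FAKES §1.15, F1-V.5)

Unit `pub-rhpf-fake-1` of the `pub-rhpf` cell (mechanism / rigidity campaign; **no RH claims**).

THEOREM-informal F1-V.5 (FAKES §1.15 RIDER) says that, granted the adiabatic transfer, the ROUND
member of the twin family of `H_L` (`U = e^L`) carries, after the Poisson smoothing of the AP-test, a
transient `(1/log(t/2π)) · Σ_{m,n < U prime powers, mn ≥ U} Λ(m)Λ(n)(mn)^{-3/2} cos(t log(mn))` with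
POSITIVE coefficients, and is therefore dishonest as soon as the index set
`{(m, n) : m, n < U prime powers, m·n ≥ U}` is non-empty.  This file PROVES the elementary clause used
there: for every real `U > 2` there is a PRIME `p < U` with `U ≤ p²` (so `(p, p)` is in the index set),
by the cases `U ≤ 4` (`p = 2`), `U ≤ 9` (`p = 3`) and Bertrand's postulate above `⌈√U⌉` otherwise.
Nothing about `ζ` is asserted.
-/

set_option linter.dupNamespace false

namespace Summit.RiemannHypothesis.RiemannHypothesis.Theorems.PfPersistence.Fake1.PWOneFreq

/-- For every real `U > 2` some prime `p < U` has `U ≤ p ^ 2`: the diagonal pair `(p, p)` lies in the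
index set of the round member's transient (F1-V.5), which is therefore non-empty at every depth `U > 2`.
[folklore; Bertrand's postulate] -/
theorem exists_prime_lt_and_le_sq {U : ℝ} (hU : 2 < U) :
    ∃ p : ℕ, p.Prime ∧ (p : ℝ) < U ∧ U ≤ (p : ℝ) ^ 2 := by
  by_cases h4 : U ≤ 4
  · exact ⟨2, Nat.prime_two, by exact_mod_cast hU, by norm_num; linarith⟩
  by_cases h9 : U ≤ 9
  · refine ⟨3, Nat.prime_three, ?_, ?_⟩
    · push Not at h4
      have : (3 : ℝ) < U := by linarith
      exact_mod_cast this
    · norm_num; linarith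
  push Not at h4 h9
  have hU0 : 0 ≤ U := by linarith
  set s := Real.sqrt U with hs
  have hs0 : 0 ≤ s := Real.sqrt_nonneg U
  have hs2 : s ^ 2 = U := Real.sq_sqrt hU0
  have hs3 : 3 < s := by
    nlinarith [hs2, hs0]
  set n := ⌈s⌉₊ with hn
  have hsn : s ≤ (n : ℝ) := Nat.le_ceil s
  have hn1 : (n : ℝ) < s + 1 := Nat.ceil_lt_add_one hs0
  have hn0 : n ≠ 0 := by
    intro h0
    have : (n : ℝ) = 0 := by exact_mod_cast h0
    linarith
  obtain ⟨p, hp, hnp, hp2n⟩ := Nat.exists_prime_lt_and_le_two_mul n hn0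
  refine ⟨p, hp, ?_, ?_⟩
  · have h1 : (p : ℝ) ≤ 2 * (n : ℝ) := by exact_mod_cast hp2n
    have h2 : (p : ℝ) < 2 * s + 2 := by linarith
    -- 2 s + 2 ≤ s ^ 2 = U since s > 3
    nlinarith [hs2, hs3]
  · have h1 : (n : ℝ) < (p : ℝ) := by exact_mod_cast hnp
    have h2 : s < (p : ℝ) := lt_of_le_of_lt hsn h1
    nlinarith [hs2, hs0, h2]

/-- Ordered-pair form used by F1-V.5: prime powers `m, n < U` (here a prime `p = m = n`) with
`U ≤ m * n`. [folklore; Bertrand's postulate] -/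
theorem exists_primePow_pair_lt_and_le_mul {U : ℝ} (hU : 2 < U) :
    ∃ m n : ℕ, IsPrimePow m ∧ IsPrimePow n ∧ (m : ℝ) < U ∧ (n : ℝ) < U ∧ U ≤ (m : ℝ) * n := by
  obtain ⟨p, hp, hpU, hUp⟩ := exists_prime_lt_and_le_sq hU
  exact ⟨p, p, hp.isPrimePow, hp.isPrimePow, hpU, hpU, by simpa [sq] using hUp⟩

/-- The coefficient of the diagonal pair is positive: `Λ(p)Λ(p)(p·p)^{-3/2} = (log p)² / p³ > 0` for a
prime `p` — so the transient of F1-V.5 does not vanish identically (all coefficients are `≥ 0`, equal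
frequencies add with the same sign). [folklore] -/
theorem diag_coeff_pos {p : ℕ} (hp : p.Prime) :
    0 < (ArithmeticFunction.vonMangoldt p : ℝ) * ArithmeticFunction.vonMangoldt p /
      ((p : ℝ) * p) ^ (3 / 2 : ℝ) := by
  have hΛ : (ArithmeticFunction.vonMangoldt p : ℝ) = Real.log p := by
    rw [ArithmeticFunction.vonMangoldt_apply_prime hp]
  have hp1 : (1 : ℝ) < p := by exact_mod_cast hp.one_lt
  have hlog : 0 < Real.log p := Real.log_pos hp1
  rw [hΛ]
  refine div_pos (mul_pos hlog hlog) ?_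
  exact Real.rpow_pos_of_pos (mul_pos (by linarith) (by linarith)) _

end Summit.RiemannHypothesis.RiemannHypothesis.Theorems.PfPersistence.Fake1.PWOneFreq
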